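import Summits.KontsevichZagierPeriods.KontsevichZagierPeriods.Theorems.RootDecompWalshStrataEulerDescent07
import Summits.KontsevichZagierPeriods.KontsevichZagierPeriods.Theorems.RootDecompWalshStrataPlanarSections01

/-!
# Quadratic descent on the atoms of a conic family: `[atom, w(x,y)] ∈ InBaker` for every conic weight `w`

Gen 7 (second half) of the decomposition node `WalshStrata` (route `RootDecompWalshStrata`, support item
`QuadricBakerDescent` stmt-KontsevichZagierPeriods-27597, slice `d = 3`).  The affine descent of part
`AffineDescent` is extended in two directions at once: the WEIGHT may be any polynomial of total degree
`≤ 2` (a `Conic` `w`, `w(x,y) = A_w y² + B_w(x) y + C_w(x)`), and the ATOM may be a sign atom of ANY finite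
family of conics `F : Fin k → Conic` in the open unit square (`atomFam F σ`; the adapted atoms of a quadric
normal form are the case `F = K.conic`, `Quadric₃.atom_eq_atomFam`).  THEOREM `InBaker.quad_atomFam`: for all
`k F σ w`, every representation `[atomFam F σ, w(x,y)]` lies in the Baker sector modulo KZ's rules (1)–(3);
corollary `quadDescent₂_holds` over the tree's `Quadric₃`.  These are the weights the `z`-integration of a
quadric cell produces when the leading coefficient vanishes and `B` is constant, and the conic-family form
is the one the diagonal device for the multi-affine class needs (node analysis, gen 7).
Mechanism: the planar-sections engine with the cubic potential `Φ = C_w(x) y + B_w(x) y²/2 + A_w y³/3`;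
along a root branch `y = (−B ± √D)/(2A)` of a boundary conic `Q`, `Φ(x, y) = P₁(x) ± N(x)·√D(x)` with
`deg N ≤ 2` (`Conic.root_value3`), and the new one-variable terminal `InBaker.poly_sqrt` puts
`[T ⊆ [0,1], N(x)·√(e x² + f x + g)]` in the Baker sector for EVERY polynomial `N` and ALL `e f g`:
`InBaker.poly_factor` off the degenerate stratum, `InBaker.even_nonpos` / a split at the vertex on it,
`InBaker.linear_factor` for `e = 0 ≠ f`, and the SCALED POLYNOMIAL CLASS `[T, M(x)·√m]`
(`InBaker.sqrt_const_poly`) by the monomial power chart `u = x^{n+1}`, whose pull-back of `a x^n √m dx`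
is the constant `a√m/(n+1)` (`InBaker.sqrt_const`).
[KontsevichZagier2001 §1.2; BCR1998 §2.2; this node gen 4–7]

This is part 1/3 (§27.1–27.2, namespace `…ConicDescent`: the monomial power chart, the scaled polynomial
class `InBaker.sqrt_const_poly` and the terminal `InBaker.poly_sqrt` for every polynomial and all `e f g`);
part 2/3 (`RootDecompWalshStrataQuadDescent02`) = conic families, the cubic potential and the conic section
lemma `InBaker.conic_section3`; part 3/3 (`RootDecompWalshStrataQuadDescent03`) = `InBaker.quad_atomFam` and
the corollary `quadDescent₂_holds` over the tree's `Quadric₃`.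
-/

noncomputable section

open Literature.NumberTheory.Transcendental
open MeasureTheory Set
open MvPolynomial (aeval X C)
open Literature.ModelTheory.ExponentialFields (IsSemialgebraic isSemialgebraic_univ
  isSemialgebraic_setOf_eval_pos isSemialgebraic_setOf_eval_lt isSemialgebraic_setOf_eval_le
  isSemialgebraic_setOf_eval_nonneg isSemialgebraic_setOf_eval_eq_zero
  isSemialgebraic_setOf_eval_ne_zero continuous_aeval_real tarski_seidenberg_real_holds)

namespace Summit.KontsevichZagierPeriods.RootDecompWalshStrata.ConicDescent

/-! #### 27.1 The scaled polynomial class `[T, M(x)·√m]` by the monomial power chart -/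

/-- The open half-line `{u > 0} ⊆ ℝ¹` is `ℚ`-semialgebraic.  (PRIVATE: a landed twin
`…UnfoldedStokes.LegendreAllModuliLine.M5.isSemialgebraic_posSet` lives in a module outside this chain; gate
lint `dedup.landed`.) [BCR1998 §2.2] -/
private theorem isSemialgebraic_posHalfLine : IsSemialgebraic ℚ {v : Fin 1 → ℝ | 0 < v 0} := by
  simpa using isSemialgebraic_setOf_eval_pos (k := ℚ) (R := ℝ) (X 0 : MvPolynomial (Fin 1) ℚ)

/-- The positive `k`-th root `u ↦ u^{1/k}` is `ℚ`-semialgebraic on `{u > 0}`: its graph is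
`{(u, x) | 0 < u, 0 < x, x^k = u}` (no Tarski–Seidenberg needed). [BCR1998 §2.2] -/
theorem isSemialgebraicFunOn_rootFn (k : ℕ) (hk : k ≠ 0) :
    IsSemialgebraicFunOn ℚ {v : Fin 1 → ℝ | 0 < v 0} (fun v => v 0 ^ ((k : ℝ)⁻¹)) := by
  rw [isSemialgebraicFunOn_iff]
  have h1 : IsSemialgebraic ℚ {z : Fin 2 → ℝ | 0 < z 0} := by
    simpa using isSemialgebraic_setOf_eval_pos (k := ℚ) (R := ℝ) (X 0 : MvPolynomial (Fin 2) ℚ)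
  have h2 : IsSemialgebraic ℚ {z : Fin 2 → ℝ | 0 < z 1} := by
    simpa using isSemialgebraic_setOf_eval_pos (k := ℚ) (R := ℝ) (X 1 : MvPolynomial (Fin 2) ℚ)
  have h3 : IsSemialgebraic ℚ {z : Fin 2 → ℝ | z 1 ^ k = z 0} := by
    convert isSemialgebraic_setOf_eval_eq_zero (k := ℚ) (R := ℝ)
      (X 1 ^ k - X 0 : MvPolynomial (Fin 2) ℚ) using 2 with z
    simp [sub_eq_zero]
  convert (h1.inter h2).inter h3 using 1
  ext z
  have e0 : Fin.init z 0 = z 0 := rfl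
  have e1 : z (Fin.last 1) = z 1 := rfl
  simp only [mem_setOf_eq, mem_inter_iff, e0, e1]
  constructor
  · rintro ⟨h0, hz⟩
    refine ⟨⟨h0, ?_⟩, ?_⟩
    · rw [hz]; exact Real.rpow_pos_of_pos h0 _
    · rw [hz]; exact Real.rpow_inv_natCast_pow h0.le hk
  · rintro ⟨⟨h0, h1'⟩, hz⟩
    exact ⟨h0, by rw [← hz, Real.pow_rpow_inv_natCast h1'.le hk]⟩

/-- **The scaled monomial** `[T, a x^n·√m]`, `T ⊆ {x > 0}`, `0 < m ∈ ℚ`: the MONOMIAL POWER CHART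
`x = u^{1/(n+1)}` (a `ℚ`-semialgebraic chart) pulls `a x^n √m dx` back to the scaled CONSTANT
`a√m/(n+1) du`, which is `InBaker.sqrt_const`. [KontsevichZagier2001 §1.2 rule (2); this node] -/
theorem InBaker.sqrt_const_monomial (m : ℚ) (hm : 0 < m) (a : ℚ) (n : ℕ) (r : KZ.IntegralRep 1)
    (hpos : ∀ v ∈ r.domain, 0 < v 0)
    (hr : EqOn r.integrand (fun v => (a : ℝ) * v 0 ^ n * √(qD 0 0 m (v 0))) r.domain) :
    InBaker (KZ.of r) := by
  have hqD : ∀ x : ℝ, qD 0 0 m x = m := fun x => by simp [qD]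
  have hk : n + 1 ≠ 0 := Nat.succ_ne_zero n
  obtain ⟨p, hpdef⟩ : ∃ p : ℝ, p = (((n + 1 : ℕ) : ℝ))⁻¹ := ⟨_, rfl⟩
  have hp0 : 0 < p := by rw [hpdef]; positivity
  have hT₀ := isSemialgebraic_posHalfLine
  have hg : IsSemialgebraicFunOn ℚ {v : Fin 1 → ℝ | 0 < v 0} fun v => v 0 ^ p := by
    rw [hpdef]; exact isSemialgebraicFunOn_rootFn (n + 1) hk
  have hR : IsSemialgebraicFunOn ℚ {v : Fin 1 → ℝ | 0 < v 0}
      fun v => (((a / (n + 1) : ℚ)) : ℝ) * √(qD 0 0 m (v 0)) :=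
    (isSemialgebraicFunOn_ratCast hT₀ _).mul_holds (isSemialgebraicFunOn_qD 0 0 m hT₀).sqrt_holds
  refine InBaker.of_cov₁' r hT₀ (fun u : ℝ => u ^ p) (fun u => p * u ^ (p - 1)) hg
    (fun v hv => Real.hasDerivAt_rpow_const (Or.inl (ne_of_gt hv))) (fun s hs t ht hst => ?_)
    (fun x hx => ?_) _ hR (fun v hv hvd => ?_) fun r₁ _ hri =>
      InBaker.sqrt_const m (a / (n + 1)) hm r₁ fun v _ => by rw [hri]
  · -- injectivity: apply the `(n+1)`-st power
    have hs' : 0 ≤ s 0 := le_of_lt hs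
    have ht' : 0 ≤ t 0 := le_of_lt ht
    rw [← Real.rpow_inv_natCast_pow hs' hk, ← Real.rpow_inv_natCast_pow ht' hk, ← hpdef]
    exact congrArg (fun y : ℝ => y ^ (n + 1)) hst
  · -- surjectivity: `u = x^{n+1}`
    refine ⟨fun _ => x 0 ^ (n + 1), pow_pos (hpos x hx) _, ?_⟩
    show (x 0 ^ (n + 1)) ^ p = x 0
    rw [hpdef]; exact Real.pow_rpow_inv_natCast (hpos x hx).le hk
  · -- the pull-back is the constant `a√m/(n+1)`
    have hu : 0 < v 0 := hv
    have hx' : r.integrand (lift₁ (fun u : ℝ => u ^ p) v) =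
        (a : ℝ) * (v 0 ^ p) ^ n * √(qD 0 0 m (v 0 ^ p)) := hr hvd
    have hone : (v 0 ^ p) ^ n * v 0 ^ (p - 1) = 1 := by
      rw [← Real.rpow_natCast, ← Real.rpow_mul hu.le, ← Real.rpow_add hu]
      have : p * (n : ℝ) + (p - 1) = 0 := by
        rw [hpdef]; push_cast; field_simp; ring
      rw [this, Real.rpow_zero]
    rw [hx', hqD, hqD, abs_of_pos (by positivity : 0 < p * v 0 ^ (p - 1))]
    calc (((a / (n + 1) : ℚ)) : ℝ) * √(m : ℝ) = (a : ℝ) * √(m : ℝ) * p * 1 := by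
          rw [hpdef]; push_cast; field_simp
      _ = (a : ℝ) * √(m : ℝ) * p * ((v 0 ^ p) ^ n * v 0 ^ (p - 1)) := by rw [hone]
      _ = (a : ℝ) * (v 0 ^ p) ^ n * √(m : ℝ) * (p * v 0 ^ (p - 1)) := by ring

/-- A polynomial over `ℚ` is bounded on `[0, 1]`. [folklore] -/
theorem exists_bound_aeval_Icc (M : Polynomial ℚ) :
    ∃ B : ℝ, ∀ x : ℝ, 0 ≤ x → x ≤ 1 → |Polynomial.aeval x M| ≤ B := by
  obtain ⟨B, hB⟩ := (isCompact_Icc (a := (0 : ℝ)) (b := 1)).exists_bound_of_continuousOn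
    (Polynomial.continuous_aeval M).continuousOn
  exact ⟨B, fun x h0 h1 => by simpa [Real.norm_eq_abs] using hB x ⟨h0, h1⟩⟩

/-- The scaled polynomial class on a domain inside `(0, 1]`: induction on the polynomial
(additivity by rule (1b), monomials by `InBaker.sqrt_const_monomial`). [this node] -/
theorem InBaker.sqrt_const_poly_pos (m : ℚ) (hm : 0 < m) (M : Polynomial ℚ) :
    ∀ r : KZ.IntegralRep 1, (∀ v ∈ r.domain, 0 < v 0) → r.domain ⊆ Icc 0 1 →
      EqOn r.integrand (fun v => Polynomial.aeval (v 0) M * √(qD 0 0 m (v 0))) r.domain →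
      InBaker (KZ.of r) := by
  refine Polynomial.induction_on' M ?_ ?_
  · intro p q hp hq r hpos hI hr
    have hb : Bornology.IsBounded r.domain := (Metric.isBounded_Icc (0 : Fin 1 → ℝ) 1).subset hI
    have hx : ∀ v ∈ r.domain, 0 ≤ v 0 ∧ v 0 ≤ 1 := fun v hv => ⟨(hI hv).1 0, (hI hv).2 0⟩
    obtain ⟨B, hB⟩ := exists_bound_aeval_Icc p
    obtain ⟨r₁, hd, hi⟩ : ∃ r₁ : KZ.IntegralRep 1, r₁.domain = r.domain ∧
        r₁.integrand = fun v => Polynomial.aeval (v 0) p * √(qD 0 0 m (v 0)) :=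
      ⟨bddRep r.domain r.isSemialgebraic_domain hb
        (fun v => Polynomial.aeval (v 0) p * √(qD 0 0 m (v 0)))
        ((((IsRatOn.polyAeval p IsRatOn.coord).isSemialgebraicFunOn r.isSemialgebraic_domain).mul_holds
          (isSemialgebraicFunOn_qD 0 0 m r.isSemialgebraic_domain).sqrt_holds).congr fun _ _ => rfl)
        (B * √(m : ℝ)) fun v hv => by
          rw [abs_mul, show qD 0 0 m (v 0) = m by simp [qD], abs_of_nonneg (Real.sqrt_nonneg _)]
          exact mul_le_mul_of_nonneg_right (hB _ (hx v hv).1 (hx v hv).2) (Real.sqrt_nonneg _),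
        rfl, rfl⟩
    refine InBaker.of_sub' r r₁ hd (hp r₁ (fun v hv => hpos v (hd ▸ hv)) (hd ▸ hI)
      fun v _ => by rw [hi]) (hq _ hpos hI fun v hv => ?_)
    have hv : v ∈ r.domain := hv
    rw [subRep_integrand, hi, hr hv]
    simp only [map_add]
    ring
  · intro n a r hpos _ hr
    exact InBaker.sqrt_const_monomial m hm a n r hpos fun v hv => by
      rw [hr hv]; simp only [Polynomial.aeval_monomial, eq_ratCast]

/-- **THE SCALED POLYNOMIAL CLASS.**  `[T, M(x)·√m] ∈ InBaker` for every `M ∈ ℚ[x]`, `0 < m ∈ ℚ`,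
`T ⊆ [0, 1]` (`{x = 0}` is null, `{x < 0} ∩ T = ∅`). [this node] -/
theorem InBaker.sqrt_const_poly (m : ℚ) (hm : 0 < m) (M : Polynomial ℚ) (r : KZ.IntegralRep 1)
    (hI : r.domain ⊆ Icc 0 1)
    (hr : EqOn r.integrand (fun v => Polynomial.aeval (v 0) M * √(qD 0 0 m (v 0))) r.domain) :
    InBaker (KZ.of r) := by
  refine InBaker.of_split_at 0 r (fun r₁ hd₁ hi₁ => ?_) fun r₁ hd₁ _ =>
    InBaker.of_domain_eq_empty r₁ ?_
  · refine InBaker.sqrt_const_poly_pos m hm M r₁ (fun v hv => ?_) (fun v hv => ?_) fun v hv => ?_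
    · rw [hd₁] at hv; simpa using hv.2
    · rw [hd₁] at hv; exact hI hv.1
    · rw [hd₁] at hv; rw [hi₁]; exact hr hv.1
  · rw [hd₁]
    refine eq_empty_of_forall_notMem fun v hv => ?_
    have h0 : (0 : ℝ) ≤ v 0 := (hI hv.1).1 0
    have h1 : v 0 < ((0 : ℚ) : ℝ) := hv.2
    rw [Rat.cast_zero] at h1
    exact absurd h1 (not_lt.2 h0)

/-! #### 27.2 The terminal `[T, N(x)·√(e x² + f x + g)]` for every polynomial `N` and all `e f g` -/

/-- **POLYNOMIAL × SQUARE ROOT TERMINAL.**  `[T, N(x)·√(e x² + f x + g)] ∈ InBaker` for `T ⊆ [0,1]`,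
every `N ∈ ℚ[x]` and ALL `e f g ∈ ℚ`: `e ≠ 0`, `h = g − f²/(4e) ≠ 0` — `InBaker.poly_factor`;
`e < 0`, `h = 0` — the integrand vanishes (`InBaker.even_nonpos`); `e > 0`, `h = 0` —
`√D = √e·|x − x₀|`, split at the rational vertex `x₀` and the scaled polynomial class on each side;
`e = 0 ≠ f` — `InBaker.linear_factor`; `e = f = 0` — the scaled class (`g > 0`) or zero (`g ≤ 0`).
[this node gen 6–7] -/
theorem InBaker.poly_sqrt (e f g : ℚ) (N : Polynomial ℚ) (r : KZ.IntegralRep 1)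
    (hI : r.domain ⊆ Icc 0 1)
    (hr : EqOn r.integrand (fun v => Polynomial.aeval (v 0) N * √(qD e f g (v 0))) r.domain) :
    InBaker (KZ.of r) := by
  have hdom : ∀ v ∈ r.domain, ((0 : ℚ) : ℝ) ≤ v 0 ∧ v 0 ≤ ((1 : ℚ) : ℝ) := fun v hv =>
    ⟨by simpa using (hI hv).1 0, by simpa using (hI hv).2 0⟩
  by_cases he : e = 0
  · subst he
    by_cases hf : f = 0
    · subst hf
      by_cases hg : 0 < g
      · exact InBaker.sqrt_const_poly g hg N r hI hr
      · refine InBaker.of_mem_relations (KZ.of_mem_relations_of_eqOn_zero _ fun v hv => ?_)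
        have hg' : (g : ℝ) ≤ 0 := by exact_mod_cast not_lt.1 hg
        show r.integrand v = 0
        rw [hr hv]
        simp only [qD, Rat.cast_zero, zero_mul, zero_add, Real.sqrt_eq_zero'.2 hg', mul_zero]
    · exact InBaker.linear_factor f g hf N 1 r (fun v _ => by simp) fun v hv => by
        rw [hr hv]; simp only [map_one, div_one]
  · by_cases hh : g - f ^ 2 / (4 * e) = 0
    · rcases lt_or_gt_of_ne he with he' | he'
      · exact InBaker.even_nonpos e f g he' hh.le _ r hr
      · -- `e > 0`, `h = 0`: `D = e (x − x₀)²`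
        have hD : ∀ x : ℝ, qD e f g x = (x - ((-f / (2 * e) : ℚ) : ℝ)) ^ 2 * qD 0 0 e x := fun x => by
          rw [qD_eq_vertex e f g he, hh]; simp [qD]; ring
        refine InBaker.of_split_at (-f / (2 * e)) r (fun r₁ hd₁ hi₁ => ?_) fun r₁ hd₁ hi₁ => ?_
        · refine InBaker.sqrt_const_poly e he' (N * (Polynomial.X - Polynomial.C (-f / (2 * e)))) r₁
            (fun v hv => hI (by rw [hd₁] at hv; exact hv.1)) fun v hv => ?_
          have hv' : v ∈ r.domain ∧ (((-f / (2 * e) : ℚ)) : ℝ) < v 0 := by rw [hd₁] at hv; exact hv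
          rw [hi₁, hr hv'.1]
          beta_reduce
          rw [hD, Real.sqrt_mul' _ (by simp [qD]; positivity), Real.sqrt_sq (sub_nonneg.2 hv'.2.le)]
          simp only [map_mul, map_sub, Polynomial.aeval_X, Polynomial.aeval_C, eq_ratCast]
          ring
        · refine InBaker.sqrt_const_poly e he' (N * (Polynomial.C (-f / (2 * e)) - Polynomial.X)) r₁
            (fun v hv => hI (by rw [hd₁] at hv; exact hv.1)) fun v hv => ?_
          have hv' : v ∈ r.domain ∧ v 0 < (((-f / (2 * e) : ℚ)) : ℝ) := by rw [hd₁] at hv; exact hv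
          rw [hi₁, hr hv'.1]
          beta_reduce
          rw [hD, Real.sqrt_mul' _ (by simp [qD]; positivity), Real.sqrt_sq_eq_abs,
            abs_of_neg (sub_neg.2 hv'.2)]
          simp only [map_mul, map_sub, Polynomial.aeval_X, Polynomial.aeval_C, eq_ratCast]
          ring
    · exact InBaker.poly_factor e f g he hh N 0 1 r hdom hr

end Summit.KontsevichZagierPeriods.RootDecompWalshStrata.ConicDescent
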